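import Mathlib

/-!
# Product-plus-one line — CLOUD CORE in lens currency, II: switch heights
# (localisation of the sign changes of `F₁`; the COMMON-SWITCH-HEIGHT law: exactly one sign change)

Helper file for `stmt-ValiantsHypothesis-18050` (`MatrixDescartes`), line `product_plus_one`, floor
`stub_oneChangeFloorK3`, open core (CL-F1) (clouds).  Sequel of `…ProductPlusOneLensCloudEnvelope` (p827068), same
dictionary: a cloud is `(κ, p, r)` with phase `y(u) = κ + p e^{-au} + r e^{bu}`, the company phase velocity is
`Θ' = Σ_i y_i'/(1+y_i²) = -F₁ = e^{bu}·R(u)` with the REDUCED VELOCITY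
`R(u) = Σ_i c_i(u)/(1+y_i(u)²)`, `c_i(u) = -a p_i e^{-(a+b)u} + b r_i` (`phaseVelocity_eq_exp_mul`,
`phaseVelocity_pos_iff`, `phaseVelocity_eq_zero_iff` there).  Def-free, Mathlib only (statements are
about `R`; `Θ'` has the sign of `R` and the same zeros by `phaseVelocity_pos_iff` / `_eq_zero_iff` of p827068).  Nothing here closes a
stub; VP ≠ VNP is not touched.

## What is proved
* `reducedVelocity_pos_of_coeff_pos` / `_neg_of_coeff_neg` : if every envelope coefficient `c_i(u)` is positive
  (resp. negative) then `R(u) > 0` (resp. `< 0`).  For a T5 cloud (`p_i < 0`, `r_i < 0`) `c_i(u) > 0 ⟺ u < u_i*`, the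
  row's SWITCH TIME `e^{(a+b)u_i*} = a|p_i|/(b|r_i|)` (`= (a/b)·|α_f/γ_f|`, the knee of the outer binomial
  `α_f + γ_f x^c`); so (`reducedVelocity_pos_below_switches`, `reducedVelocity_neg_above_switches`) ALL sign changes of
  `F₁` of a pure T5 company lie between the first and the last switch time — LOCALISATION, every support, every `T`.
* COMMON-SWITCH-HEIGHT LAW (`reducedVelocity_eq_of_commonSwitch`, `reducedVelocity_commonSwitch_pos/_neg/_eq_zero_iff`):
  if all clouds of an upper-aligned company (`r_i < 0`) have the SAME switch height `w` (`a p_i = w b r_i` for all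
  `i`, i.e. all outer binomials `α_f + γ_f x^c` share one knee `|α_f/γ_f| = const`), then
  `R(u) = (1 - w e^{-(a+b)u}) · Σ_i b r_i/(1+y_i²)`, so `R` (hence `F₁`) is positive before `u* = log w/(a+b)`,
  negative after, and vanishes ONLY at `u*`: EXACTLY ONE sign change of `F₁` for ANY number of clouds at ANY phases —
  a cloud class with unboundedly many trinomial rows on which (CL-1′) holds with constant 1 (with the paper lens
  inequality of the NOTE §2 this gives `Z₊ ≤ #real poles + 2` there; the lens inequality itself is not kernel).
-/

set_option linter.dupNamespace false

open Real Finset BigOperators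

namespace Summit.ValiantsHypothesis.ValiantsHypothesis.Theorems.LacunarySymmetroidMatrixDescartes.ProductPlusOne.LensCloudSwitch

variable {ι : Type*} [Fintype ι]

/-- all envelope coefficients positive ⇒ reduced velocity positive (nonempty company). [this file's lemma] -/
theorem reducedVelocity_pos_of_coeff_pos [Nonempty ι] (a b κ u : ℝ) (p r : ι → ℝ)
    (h : ∀ i, 0 < -(a * p i) * exp (-((a + b) * u)) + b * r i) :
    0 < ∑ i, (-(a * p i) * exp (-((a + b) * u)) + b * r i)
        / (1 + (κ + p i * exp (-(a * u)) + r i * exp (b * u)) ^ 2) := by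
  apply Finset.sum_pos _ Finset.univ_nonempty
  intro i _
  exact div_pos (h i) (by positivity)

/-- all envelope coefficients negative ⇒ reduced velocity negative (nonempty company). [this file's lemma] -/
theorem reducedVelocity_neg_of_coeff_neg [Nonempty ι] (a b κ u : ℝ) (p r : ι → ℝ)
    (h : ∀ i, -(a * p i) * exp (-((a + b) * u)) + b * r i < 0) :
    ∑ i, (-(a * p i) * exp (-((a + b) * u)) + b * r i)
        / (1 + (κ + p i * exp (-(a * u)) + r i * exp (b * u)) ^ 2) < 0 := by
  apply Finset.sum_neg _ Finset.univ_nonempty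
  intro i _
  exact div_neg_of_neg_of_pos (h i) (by positivity)

/-- **T5 envelope coefficient below the switch**: `p < 0`, `r < 0`, and `b|r| e^{(a+b)u} < a|p|`
(i.e. `u < u*`) ⇒ `c(u) > 0`. [this file's lemma] -/
theorem coeff_pos_of_below_switch (a b p r u : ℝ)
    (hu : b * (-r) * exp ((a + b) * u) < a * (-p)) :
    0 < -(a * p) * exp (-((a + b) * u)) + b * r := by
  have hE : 0 < exp (-((a + b) * u)) := exp_pos _
  have hEE : exp ((a + b) * u) * exp (-((a + b) * u)) = 1 := by
    rw [← Real.exp_add]; simp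
  have h1 : b * (-r) * exp ((a + b) * u) * exp (-((a + b) * u)) < a * (-p) * exp (-((a + b) * u)) :=
    mul_lt_mul_of_pos_right hu hE
  have h2 : b * (-r) * exp ((a + b) * u) * exp (-((a + b) * u)) = b * (-r) := by
    rw [mul_assoc, hEE, mul_one]
  linarith

/-- **T5 envelope coefficient above the switch**: `a|p| < b|r| e^{(a+b)u}` (i.e. `u* < u`) ⇒ `c(u) < 0`.
[this file's lemma] -/
theorem coeff_neg_of_above_switch (a b p r u : ℝ)
    (hu : a * (-p) < b * (-r) * exp ((a + b) * u)) :
    -(a * p) * exp (-((a + b) * u)) + b * r < 0 := by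
  have hE : 0 < exp (-((a + b) * u)) := exp_pos _
  have hEE : exp ((a + b) * u) * exp (-((a + b) * u)) = 1 := by
    rw [← Real.exp_add]; simp
  have h1 : a * (-p) * exp (-((a + b) * u)) < b * (-r) * exp ((a + b) * u) * exp (-((a + b) * u)) :=
    mul_lt_mul_of_pos_right hu hE
  have h2 : b * (-r) * exp ((a + b) * u) * exp (-((a + b) * u)) = b * (-r) := by
    rw [mul_assoc, hEE, mul_one]
  linarith

/-- **LOCALISATION (below)**: before the first switch time of the company the reduced velocity is positive,
so `F₁` has no zero and no sign change there. [this file's theorem] -/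
theorem reducedVelocity_pos_below_switches [Nonempty ι] (a b κ u : ℝ) (p r : ι → ℝ)
    (hu : ∀ i, b * (-r i) * exp ((a + b) * u) < a * (-p i)) :
    0 < ∑ i, (-(a * p i) * exp (-((a + b) * u)) + b * r i)
        / (1 + (κ + p i * exp (-(a * u)) + r i * exp (b * u)) ^ 2) :=
  reducedVelocity_pos_of_coeff_pos a b κ u p r fun i => coeff_pos_of_below_switch a b (p i) (r i) u (hu i)

/-- **LOCALISATION (above)**: after the last switch time the reduced velocity is negative. [this file's theorem] -/
theorem reducedVelocity_neg_above_switches [Nonempty ι] (a b κ u : ℝ) (p r : ι → ℝ)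
    (hu : ∀ i, a * (-p i) < b * (-r i) * exp ((a + b) * u)) :
    ∑ i, (-(a * p i) * exp (-((a + b) * u)) + b * r i)
        / (1 + (κ + p i * exp (-(a * u)) + r i * exp (b * u)) ^ 2) < 0 :=
  reducedVelocity_neg_of_coeff_neg a b κ u p r fun i => coeff_neg_of_above_switch a b (p i) (r i) u (hu i)

/-! ### The common-switch-height law -/

/-- **Common switch height ⇒ the reduced velocity FACTORS**: if `a p_i = w·(b r_i)` for every row then
`R(u) = (1 - w e^{-(a+b)u}) · Σ_i b r_i/(1+y_i²)`. [this file's theorem] -/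
theorem reducedVelocity_eq_of_commonSwitch (a b κ u w : ℝ) (p r : ι → ℝ)
    (hw : ∀ i, a * p i = w * (b * r i)) :
    ∑ i, (-(a * p i) * exp (-((a + b) * u)) + b * r i)
        / (1 + (κ + p i * exp (-(a * u)) + r i * exp (b * u)) ^ 2)
      = (1 - w * exp (-((a + b) * u)))
        * ∑ i, (b * r i) / (1 + (κ + p i * exp (-(a * u)) + r i * exp (b * u)) ^ 2) := by
  rw [Finset.mul_sum]
  refine Finset.sum_congr rfl fun i _ => ?_
  rw [hw i]
  ring

/-- the weight sum `Σ_i b r_i/(1+y_i²)` of an upper-aligned company (`b > 0`, all `r_i < 0`) is negative.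
[this file's lemma] -/
theorem weightSum_neg [Nonempty ι] (a b κ u : ℝ) (p r : ι → ℝ) (hb : 0 < b) (hr : ∀ i, r i < 0) :
    ∑ i, (b * r i) / (1 + (κ + p i * exp (-(a * u)) + r i * exp (b * u)) ^ 2) < 0 := by
  apply Finset.sum_neg _ Finset.univ_nonempty
  intro i _
  exact div_neg_of_neg_of_pos (mul_neg_of_pos_of_neg hb (hr i)) (by positivity)

/-- **COMMON-SWITCH-HEIGHT LAW, sign below**: `w e^{-(a+b)u} > 1` (before the common switch) ⇒ `R(u) > 0`.
[this file's theorem] -/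
theorem reducedVelocity_commonSwitch_pos [Nonempty ι] (a b κ u w : ℝ) (p r : ι → ℝ) (hb : 0 < b)
    (hr : ∀ i, r i < 0) (hw : ∀ i, a * p i = w * (b * r i)) (hu : 1 < w * exp (-((a + b) * u))) :
    0 < ∑ i, (-(a * p i) * exp (-((a + b) * u)) + b * r i)
        / (1 + (κ + p i * exp (-(a * u)) + r i * exp (b * u)) ^ 2) := by
  rw [reducedVelocity_eq_of_commonSwitch a b κ u w p r hw]
  exact mul_pos_of_neg_of_neg (by linarith) (weightSum_neg a b κ u p r hb hr)

/-- **COMMON-SWITCH-HEIGHT LAW, sign above**: `w e^{-(a+b)u} < 1` ⇒ `R(u) < 0`. [this file's theorem] -/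
theorem reducedVelocity_commonSwitch_neg [Nonempty ι] (a b κ u w : ℝ) (p r : ι → ℝ) (hb : 0 < b)
    (hr : ∀ i, r i < 0) (hw : ∀ i, a * p i = w * (b * r i)) (hu : w * exp (-((a + b) * u)) < 1) :
    ∑ i, (-(a * p i) * exp (-((a + b) * u)) + b * r i)
        / (1 + (κ + p i * exp (-(a * u)) + r i * exp (b * u)) ^ 2) < 0 := by
  rw [reducedVelocity_eq_of_commonSwitch a b κ u w p r hw]
  exact mul_neg_of_pos_of_neg (by linarith) (weightSum_neg a b κ u p r hb hr)

/-- **COMMON-SWITCH-HEIGHT LAW, zero set**: `R(u) = 0 ⟺ w e^{-(a+b)u} = 1` — the reduced velocity (hence `F₁`)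
vanishes ONLY at the common switch time, whatever the number of clouds and their phases. [this file's theorem] -/
theorem reducedVelocity_commonSwitch_eq_zero_iff [Nonempty ι] (a b κ u w : ℝ) (p r : ι → ℝ) (hb : 0 < b)
    (hr : ∀ i, r i < 0) (hw : ∀ i, a * p i = w * (b * r i)) :
    ∑ i, (-(a * p i) * exp (-((a + b) * u)) + b * r i)
        / (1 + (κ + p i * exp (-(a * u)) + r i * exp (b * u)) ^ 2) = 0
      ↔ w * exp (-((a + b) * u)) = 1 := by
  rw [reducedVelocity_eq_of_commonSwitch a b κ u w p r hw, mul_eq_zero]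
  constructor
  · rintro (h | h)
    · linarith
    · exact absurd h (weightSum_neg a b κ u p r hb hr).ne
  · intro h
    left
    linarith

end Summit.ValiantsHypothesis.ValiantsHypothesis.Theorems.LacunarySymmetroidMatrixDescartes.ProductPlusOne.LensCloudSwitch
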